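/-
Copyright (c) 2026 the pub-hodgecm-mathlib formalisation cell (harness21).  Prover seat hodgecm-mathlib-LH4-p07 (g2): Track A «(D-RAM) FOUR-FRAME» squad of crux H413
(dealer LH4-plan (g10) WORD #42 (2) ∕ LH4-p05 (g0) 22:43:09Z: «(C2) Δ‴ Levi value `|2|`-free → p07»), 2026-09-03.
-/
import Literature.NumberTheory.Rogawski1990.FinExplicitTransferFactorLeviStratum          -- ★ T5-Levi (inert): §1 Levi bookkeeping, §2 one class, ★ `finKappaAt_eq_one_of_eigenvector_of_exists`, ★ `localNonsplitCongr`
import Literature.NumberTheory.Rogawski1990.FinExplicitTransferFactorDeepValueRamified      -- ★ R-4c⁺∕T5-b′: `localComponent_map_toPlace_eq_hilbertSymbol` (guard → symbol), `exists_finHeckeValue_eq_one_of_valued_sub_one_le`, `finHeckeValue_mul`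
import Literature.NumberTheory.Rogawski1990.RamifiedPlaceNormSymbolDichotomy               -- ★ `hilbertSymbol_eq_one_iff_exists_norm_toPlace` (the norm reading of `(·, θ)_v`)
import Literature.NumberTheory.Rogawski1990.UnitFundamentalLemmaInertLevi                  -- ★ FILE F: `isUnit_vecCons_sub_of_levi`, `endoEmbLocal_mem_cmLocalIntegralLevel_of_nonsplit` (the consumer's binder currency)
import Literature.NumberTheory.Rogawski1990.FinExplicitTransferFactorLocallyConstant       -- ★ `continuous_fst_localMatrix`
import Literature.NumberTheory.Automorphic.UnitaryGroupInertPlaceHyperbolicBasis           -- ★ `exists_toPlace_eq_of_galAdicCompletionMap_eq`, `galAdicCompletionMap_galAdicCompletionMap_of_smul_eq`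
import HarnessLib

/-!
# Rogawski's transfer factor on the LEVI (split-torus) stratum at ANY non-split place: `Δ‴_v(γ_H, γ₀) = μ_v(d₀) · ‖d₀⁻¹u − 1‖`
# — no `|2|_w = 1`, no `e(w|v) = 1`, no «`μ` unramified»
(Rogawski (1990) §4.9 p. 55 (`τ`, `D_{G∕H}`, `μ|_{F^×} = ω_{E∕F}`), Prop. 4.9.1 (b); §4.3 p. 43; §14.6 p. 242; §3.5 Prop. 3.5.2 (c))

Topic `NumberTheory/Rogawski1990`; namespace `Literature.NumberTheory.Rogawski1990`.  KERNEL mathematics only: theorems, no definition, no named fact, no instance, no notation,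
no `sorry`.  Cell `pub/hodgecm-mathlib`, crux H413 = `stmt-HodgeConjecture-24833` (count-neutral), Track A «(D-RAM) FOUR-FRAME», unit U2H child (f) `stub_U2H_leviRow_wild`
(LH4-p05 (g0) census v2 8155187a2585211d §C «Δ‴ on Levi matches: wild twin S–M»): the binder `hΔ` of ★ L7 `UnitFundamentalLemmaLeviOfFormCongr` at a WILD ramified place.
HONEST LABEL: HC_CM is proved only modulo the 7 printed citations (2 remaining named inputs: hLiu418 = `stmt-HodgeConjecture-24832`, h413 = `stmt-HodgeConjecture-24833`)
until rung 0 closes; this file is unconditional, asserts nothing printed, freezes no stub text, discharges no named fact.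

THE MATHEMATICS (`L` CM, `v` a finite place of `L⁺` NON-SPLIT in `L`, `w ∣ v`, `σ = σ_w`, ANY ramification; `μ` a Hecke character of `L` with print's guard
`μ|_{𝕀_{L⁺}} = ω_{L∕L⁺}`; `H′` hermitian with the integral congruence binder `H′_w = ᵗσT·Φ₃·T`, `T ∈ GL₃(𝒪_w)` of ★ L6∕L7 — `T = 1` for `H′ = Φ₃`).  Let `γ_H ∈ H_v` lie on the
LEVI STRATUM: `ι_v(γ_H) = diag(d₀, u, d₂) ∈ T(L⁺_v) ≤ U(Φ₃)(L⁺_v)`, so (torus relations ★ `HeisRing.torus_relations`) `d₂ = σ(d₀)⁻¹`, `σu = u⁻¹`; put `a := d₀⁻¹u`.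
The explicit factor is `Δ‴_v(γ_H, γ₀) = τ_v(γ_H) · D_v(γ_H) · κ_v(γ_H, γ₀)` on matched pairs (★ `finExplicitDelta_of_isLocalNormPair`).
* §1 **`μ_v(z · σz) = 1`** for every unit `z` of `E_v = L_w` (guard): `z·σz = ι_w(N z)` (★ `exists_toPlace_eq_of_galAdicCompletionMap_eq`), `μ_w(ι_w y) = (y, θ)_v` (★
  `localComponent_map_toPlace_eq_hilbertSymbol`), and `(N z, θ)_v = 1` (★ `hilbertSymbol_eq_one_iff_exists_norm_toPlace`); hence `μ_v(σz) = μ_v(z)⁻¹`.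
* §2 **`τ_v(γ_H) = μ_v(d₀)`** EXACTLY: `τ_v = μ_v(u)·μ_v(t)⁻¹`, `t = −χ_g(u)·det g⁻¹` (★ `finTau`, `finTauArg`), and on the stratum `χ_g(u) = −d₀u·(a−1)σ(a−1)` (★
  `HeisRing.weylNumerator_eq`), `det g⁻¹ = (d₀d₂)⁻¹ = d₀⁻¹σ(d₀)`, so `t = u · σ(d₀) · (a−1)σ(a−1)` and `μ_v(t) = μ_v(u)·μ_v(d₀)⁻¹·1` by §1.  (At an unramified place with
  `μ_w` unramified `μ_v(d₀) = 1` on `T(𝒪_v)` — ★ T5-Levi's `τ_v = 1`; at a ramified place `μ_w` is ramified and `μ_v(d₀) ≠ 1` in general: the one wild novelty.)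
* §3 **`κ_v(γ_H, γ₀) = +1`** over the congruence binder: ★ T5-Levi §3 VERBATIM with Jacobowitz's `T` replaced by the binder's (`ψ = localNonsplitCongr T`, `γ₁ = ψ⁻¹(ι_vγ_H)`,
  eigenvector `p′ = T⁻¹e₂`, `H′(p′,p′) = (Φ₃)₂₂ = 1` a norm ★ `finKappaAt_eq_one_of_eigenvector_of_exists`; one class on the stratum ★ `isConj_of_isLocalNormPair_of_isLocalNormPair_of_levi`,
  class function ★ `finKappaAt_conj_right`).
* §4 HEAD **`finExplicitDelta_eq_finHeckeValue_mul_unitModulusChar_of_levi_of_formCongr`**: with `D_v = ‖a − 1‖·√‖d₀‖ = ‖a − 1‖` on `T(𝒪_v)` (★ `sqrt_prod_norm_weylNumerator_cmLocal`,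
  ★ `unitModulusChar_eq_one_of_endoEmbLocal_mem`): **`Δ‴_v(γ_H, γ₀) = μ_v(d₀) · ‖d₀⁻¹u − 1‖`** at every matching `γ₀` — ★ T5-Levi HEAD's binders with `(hv, hH′w, hH′i, hμ) ↦ hJT` and the
  honest factor `μ_v(d₀)`; + the `Φ₃`∕`T = 1` twin.
* §5 THE L7-FACING GERM **`exists_nhds_one_forall_finExplicitDelta_eq_unitModulusChar_of_levi_of_formCongr`**: `μ_w` is trivial near `1` (★
  `exists_finHeckeValue_eq_one_of_valued_sub_one_le`) and `γ_H ↦ (d₀)_w = (g₀₀)_w` is continuous (★ `continuous_fst_localMatrix`), so on a neighbourhood `V ∋ 1` of `H_v`: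
  **`Δ‴_v(γ_H, γ₀) = ‖d′₀⁻¹u − 1‖`** in the binder currency of ★ L7 `stableOrbitalIntegralRel_indicator_eq_finsum_delta_of_levi_of_formCongr` (`hd′ hγH ha hb h12` VERBATIM) — its `hΔ`; + the
  `Φ₃` twin.
NOT here: the `H`-side values, the transport of classes, the assembly of the Levi row (★ L7 and the U2H edition).

## References
* [Rogawski1990] J. D. Rogawski, *Automorphic Representations of Unitary Groups in Three Variables*, Ann. of Math. Stud. 123 (1990): §4.9 p. 55, Prop. 4.9.1 (b); §4.3 p. 43;
  §14.6 p. 242; §3.5 Prop. 3.5.2 (c) p. 26.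
* [LanglandsShelstad1987] R. P. Langlands, D. Shelstad, *On the definition of transfer factors*, Math. Ann. 278 (1987), §2.
* [Serre1979] J.-P. Serre, *Local Fields*, GTM 67 (1979): Ch. XIV §3 (the local symbol).
* [Omeara1963] O. T. O'Meara, *Introduction to Quadratic Forms* (1963), §63B.
* [TateThesis1967] J. Tate, *Fourier analysis in number fields and Hecke's zeta-functions*, §2.3.
-/

set_option autoImplicit false

noncomputable section

open NumberField IsDedekindDomain Filter Topology Matrix
open scoped NNReal Matrix MatrixGroups

namespace Literature.NumberTheory.Rogawski1990

open Literature.NumberTheory.Automorphic Literature.NumberTheory.Automorphic.UnitaryGroup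
open Literature.NumberTheory.GaloisRepresentations Literature.NumberTheory.GaloisRepresentations.IsNonarchimedeanLocalField
open Literature.NumberTheory.QuadraticForms

/-! ## §1 `μ_v(z · σz) = 1` under the guard `μ|_{𝕀_{L⁺}} = ω_{L∕L⁺}` -/

/-- **`μ_v(z · σ_w z) = 1` FOR EVERY UNIT `z` OF `E_v = L_w`** at a non-split place `v`, under print's guard `μ|_{𝕀_{L⁺}} = ω_{L∕L⁺}` and with NO ramification hypothesis:
`z·σz` is `σ_w`-fixed, hence `= ι_w y` with `y ∈ L⁺_v` (★ `exists_toPlace_eq_of_galAdicCompletionMap_eq`); `μ_w(ι_w y) = (y, θ)_v` (★ `localComponent_map_toPlace_eq_hilbertSymbol`);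
and `y` is a norm from `L_w`, so `(y, θ)_v = 1` (★ `hilbertSymbol_eq_one_iff_exists_norm_toPlace`).  Print: «`μ|_{F^×} = ω_{E∕F}`», and `ω` kills norms.
[cite: Rogawski1990, §4.9 p. 55] [cite: Serre1979, Ch. XIV §3] -/
theorem finHeckeValue_mul_conjLocal_self_eq_one (L : Type) [Field L] [NumberField L] [IsCMField L]
    {v : HeightOneSpectrum (𝓞 ↥(maximalRealSubfield L))} (w : PlacesOver L v) (hw : IsCMField.complexConj L • w.1 = w.1)
    (μ : HeckeCharacter L)
    (hμω : ∀ x : ideleGroup ↥(maximalRealSubfield L), μ (AdeleRing.ideleBaseChange ↥(maximalRealSubfield L) L x) = quadraticHeckeCharCM L x)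
    {z : UnitaryGroup.LocalRing L v} (hz : IsUnit z) :
    finHeckeValue L v μ (z * UnitaryGroup.conjLocal L (IsCMField.complexConj L) v z) = 1 := by
  classical
  have hc := IsCMField.complexConj_ne_one L
  haveI : Algebra.IsQuadraticExtension ↥(maximalRealSubfield L) L := IsCMField.isQuadraticExtension L
  have hN : IsUnit (z * UnitaryGroup.conjLocal L (IsCMField.complexConj L) v z) := hz.mul (hz.map _)
  have hNw : (z * UnitaryGroup.conjLocal L (IsCMField.complexConj L) v z) w =
      z w * galAdicCompletionMap (L := L) (IsCMField.complexConj L) hw (z w) := by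
    rw [Pi.mul_apply, conjLocal_apply_eq_galAdicCompletionMap L v w hw]
  have hfix : galAdicCompletionMap (L := L) (IsCMField.complexConj L) hw ((z * UnitaryGroup.conjLocal L (IsCMField.complexConj L) v z) w) =
      (z * UnitaryGroup.conjLocal L (IsCMField.complexConj L) v z) w := by
    rw [hNw, map_mul, galAdicCompletionMap_galAdicCompletionMap_of_smul_eq (IsCMField.complexConj L) w hc hw, mul_comm]
  obtain ⟨y, hy⟩ := exists_toPlace_eq_of_galAdicCompletionMap_eq (IsCMField.complexConj L) w hc hw _ hfix
  have hNw0 : (z * UnitaryGroup.conjLocal L (IsCMField.complexConj L) v z) w ≠ 0 := (Pi.isUnit_iff.1 hN w).ne_zero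
  have hy0 : y ≠ 0 := fun h0 => hNw0 (by rw [← hy, h0, map_zero])
  have hunit : MulEquiv.piUnits hN.unit w =
      Units.map (toPlace v w : v.adicCompletion ↥(maximalRealSubfield L) →* w.1.adicCompletion L) (Units.mk0 y hy0) := by
    ext
    rw [Units.coe_map, MonoidHom.coe_coe, Units.val_mk0, hy]
    rfl
  rw [finHeckeValue_eq_localComponent_of_nonsplit L v w hw μ hN, hunit, localComponent_map_toPlace_eq_hilbertSymbol L v w hw μ hμω (Units.mk0 y hy0),
    Units.val_mk0, (hilbertSymbol_eq_one_iff_exists_norm_toPlace L v w hw hy0).2 ⟨z w, by rw [hy, hNw, mul_comm]⟩, Int.cast_one]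

/-- **`μ_v(σ_w z) = μ_v(z)⁻¹`** for every unit `z` of `E_v` (§1 solved; `μ_v` multiplicative on units ★ `finHeckeValue_mul`). [cite: Rogawski1990, §4.9 p. 55] -/
theorem finHeckeValue_conjLocal_eq_inv (L : Type) [Field L] [NumberField L] [IsCMField L]
    {v : HeightOneSpectrum (𝓞 ↥(maximalRealSubfield L))} (w : PlacesOver L v) (hw : IsCMField.complexConj L • w.1 = w.1)
    (μ : HeckeCharacter L)
    (hμω : ∀ x : ideleGroup ↥(maximalRealSubfield L), μ (AdeleRing.ideleBaseChange ↥(maximalRealSubfield L) L x) = quadraticHeckeCharCM L x)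
    {z : UnitaryGroup.LocalRing L v} (hz : IsUnit z) :
    finHeckeValue L v μ (UnitaryGroup.conjLocal L (IsCMField.complexConj L) v z) = (finHeckeValue L v μ z)⁻¹ := by
  have h := finHeckeValue_mul_conjLocal_self_eq_one L w hw μ hμω hz
  rw [finHeckeValue_mul L v μ hz (hz.map _)] at h
  exact eq_inv_of_mul_eq_one_right h

/-! ## §2 `τ_v(γ_H) = μ_v(d₀)` on the Levi stratum -/

/-- **`τ_v(γ_H) = μ_v(d₀)` ON THE LEVI STRATUM, AT ANY NON-SPLIT PLACE.**  For `γ_H ∈ H_v` with `ι_v(γ_H) = diag(d₀, d₁, d₂) ∈ T(L⁺_v)` and `a − 1 = d₀⁻¹d₁ − 1` a unit,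
under the guard: `τ_v(γ_H) = μ_v(d₁) · μ_v(t)⁻¹` with `t = −χ_g(d₁)·det g⁻¹ = d₁ · σ(d₀) · (a − 1)σ(a − 1)` (`χ_g(d₁) = −d₀d₁(a−1)σ(a−1)` ★ `HeisRing.weylNumerator_eq`,
`det g = d₀d₂`, `d₂⁻¹ = σ(d₀)` ★ `HeisRing.torus_relations`), and `μ_v((a−1)σ(a−1)) = 1`, `μ_v(σd₀) = μ_v(d₀)⁻¹` (§1).  Print: «`τ(γ) = μ(γ₂)μ⁻¹((γ₂γ₁⁻¹ − 1)(1 − γ₂γ₃⁻¹))`».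
[cite: Rogawski1990, §4.9 p. 55] -/
theorem finTau_eq_finHeckeValue_of_levi (L : Type) [Field L] [NumberField L] [IsCMField L]
    {v : HeightOneSpectrum (𝓞 ↥(maximalRealSubfield L))} (w : PlacesOver L v) (hw : IsCMField.complexConj L • w.1 = w.1)
    (μ : HeckeCharacter L)
    (hμω : ∀ x : ideleGroup ↥(maximalRealSubfield L), μ (AdeleRing.ideleBaseChange ↥(maximalRealSubfield L) L x) = quadraticHeckeCharCM L x)
    (γH : (cmDatum L 2 (Matrix.of fun i j : Fin 2 => if i.val + j.val + 1 = 2 then (1 : L) else 0)).Local v ×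
      (cmDatum L 1 (Matrix.of fun i j : Fin 1 => if i.val + j.val + 1 = 1 then (1 : L) else 0)).Local v)
    {d : Fin 3 → (UnitaryGroup.LocalRing L v)ˣ}
    (hι : ((endoEmbLocal L v γH).val : GL (Fin 3) (UnitaryGroup.LocalRing L v)) = glDiagonal 3 (UnitaryGroup.LocalRing L v) d)
    (ha : IsUnit ((((d 0)⁻¹ * d 1 : (UnitaryGroup.LocalRing L v)ˣ) : UnitaryGroup.LocalRing L v) - 1)) :
    finTau L v γH μ = finHeckeValue L v μ (d 0) := by
  have ht := endoEmbLocal_mem_torusU_of_endoEmbLocal_eq L v γH hι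
  obtain ⟨-, -, h02⟩ := HeisRing.torus_relations (conjLocal L (IsCMField.complexConj L) v) (cmLocalForm_eq_over L 3 v) ⟨_, ht⟩ hι.symm
  -- `det g⁻¹ = (d₀ d₂)⁻¹`
  have hdetg : ((γH.1.val).val : Matrix (Fin 2) (Fin 2) (UnitaryGroup.LocalRing L v)).det = ((d 0 * d 2 : (UnitaryGroup.LocalRing L v)ˣ) : UnitaryGroup.LocalRing L v) := by
    rw [coe_fst_eq_diagonal_of_endoEmbLocal_eq L v γH hι]
    simp only [Matrix.det_diagonal, Fin.prod_univ_two, Matrix.cons_val_zero, Matrix.cons_val_one, Units.val_mul]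
  have hdet : ((γH.1.val⁻¹).val : Matrix (Fin 2) (Fin 2) (UnitaryGroup.LocalRing L v)).det =
      (((d 0 * d 2)⁻¹ : (UnitaryGroup.LocalRing L v)ˣ) : UnitaryGroup.LocalRing L v) := by
    have h1 : ((γH.1.val⁻¹).val : Matrix (Fin 2) (Fin 2) (UnitaryGroup.LocalRing L v)).det *
        ((γH.1.val).val : Matrix (Fin 2) (Fin 2) (UnitaryGroup.LocalRing L v)).det = 1 := by
      rw [← Matrix.det_mul, ← Units.val_mul, inv_mul_cancel, Units.val_one, Matrix.det_one]
    rw [hdetg] at h1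
    exact Units.eq_inv_of_mul_eq_one_right h1
  -- `(d₀d₂)⁻¹ = σ(d₀) · d₀⁻¹`
  have hd2 : (((d 2)⁻¹ : (UnitaryGroup.LocalRing L v)ˣ) : UnitaryGroup.LocalRing L v) = conjLocal L (IsCMField.complexConj L) v (d 0 : UnitaryGroup.LocalRing L v) :=
    Units.inv_eq_of_mul_eq_one_left h02
  have hinv : (((d 0 * d 2)⁻¹ : (UnitaryGroup.LocalRing L v)ˣ) : UnitaryGroup.LocalRing L v) =
      conjLocal L (IsCMField.complexConj L) v (d 0 : UnitaryGroup.LocalRing L v) * (((d 0)⁻¹ : (UnitaryGroup.LocalRing L v)ˣ) : UnitaryGroup.LocalRing L v) := by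
    rw [_root_.mul_inv_rev, Units.val_mul, hd2]
  -- `t = d₁ · σ(d₀) · ((a−1)·σ(a−1))`
  have harg : finTauArg L v γH = (d 1 : UnitaryGroup.LocalRing L v) * (conjLocal L (IsCMField.complexConj L) v (d 0 : UnitaryGroup.LocalRing L v) *
      (((((d 0)⁻¹ * d 1 : (UnitaryGroup.LocalRing L v)ˣ) : UnitaryGroup.LocalRing L v) - 1) *
        conjLocal L (IsCMField.complexConj L) v ((((d 0)⁻¹ * d 1 : (UnitaryGroup.LocalRing L v)ˣ) : UnitaryGroup.LocalRing L v) - 1))) := by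
    unfold finTauArg
    rw [eval_finCharpolyTwo_eq_of_endoEmbLocal_eq L v γH hι,
      HeisRing.weylNumerator_eq (conjLocal L (IsCMField.complexConj L) v) (cmLocalForm_eq_over L 3 v) ⟨_, ht⟩ hι.symm, hdet, hinv, neg_neg]
    have e : (d 0 : UnitaryGroup.LocalRing L v) * (((d 0)⁻¹ : (UnitaryGroup.LocalRing L v)ˣ) : UnitaryGroup.LocalRing L v) = 1 := Units.mul_inv _
    linear_combination ((d 1 : UnitaryGroup.LocalRing L v) * conjLocal L (IsCMField.complexConj L) v (d 0 : UnitaryGroup.LocalRing L v) *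
      (((((d 0)⁻¹ * d 1 : (UnitaryGroup.LocalRing L v)ˣ) : UnitaryGroup.LocalRing L v) - 1) *
        conjLocal L (IsCMField.complexConj L) v ((((d 0)⁻¹ * d 1 : (UnitaryGroup.LocalRing L v)ˣ) : UnitaryGroup.LocalRing L v) - 1))) * e
  have hA : IsUnit (((((d 0)⁻¹ * d 1 : (UnitaryGroup.LocalRing L v)ˣ) : UnitaryGroup.LocalRing L v) - 1) *
      conjLocal L (IsCMField.complexConj L) v ((((d 0)⁻¹ * d 1 : (UnitaryGroup.LocalRing L v)ˣ) : UnitaryGroup.LocalRing L v) - 1)) := ha.mul (ha.map _)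
  have hσd0 : IsUnit (conjLocal L (IsCMField.complexConj L) v (d 0 : UnitaryGroup.LocalRing L v)) := (d 0).isUnit.map _
  have h1 : finHeckeValue L v μ (d 1 : UnitaryGroup.LocalRing L v) ≠ 0 := finHeckeValue_ne_zero_of_isUnit L v μ (d 1).isUnit
  have h0 : finHeckeValue L v μ (d 0 : UnitaryGroup.LocalRing L v) ≠ 0 := finHeckeValue_ne_zero_of_isUnit L v μ (d 0).isUnit
  unfold finTau
  rw [finGammaTwo_eq_of_endoEmbLocal_eq L v γH hι, harg, finHeckeValue_mul L v μ (d 1).isUnit (hσd0.mul hA), finHeckeValue_mul L v μ hσd0 hA,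
    finHeckeValue_mul_conjLocal_self_eq_one L w hw μ hμω ha, finHeckeValue_conjLocal_eq_inv L w hw μ hμω (d 0).isUnit, mul_one, mul_inv, inv_inv,
    ← mul_assoc, mul_inv_cancel₀ h1, one_mul]

/-! ## §3 `κ_v(γ_H, γ₀) = +1` on the Levi stratum over the congruence binder `H′_w = ᵗσT·Φ₃·T` -/

/-- `IsConj` descends along a multiplicative equivalence. [cite: Rogawski1990, §3.1 p. 19] -/
private theorem isConj_of_isConj_mulEquiv_aux' {G G' : Type*} [Monoid G] [Monoid G'] (e : G ≃* G') {a b : G}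
    (h : IsConj (e a) (e b)) : IsConj a b := by
  have h' := MonoidHom.map_isConj e.symm.toMonoidHom h
  simpa using h'

/-- **The comparison `ψ : U(H′)(L⁺_v) ≃ U(Φ₃)(L⁺_v)` FROM THE CONGRUENCE BINDER** (hypothesis form of ★ T5-Levi §0 `exists_continuousMulEquiv_level_formCongr_of_nonsplit`, the
Jacobowitz step replaced by `hJT`): `ψ =` ★ `localNonsplitCongr T`, `ψ g ∼ g` in `GL₃(∏_{w′∣v} L_{w′})`, `(ψ g)_w = T g_w T⁻¹`, and the form identity is re-exported for the SAME
`T`. [cite: Rogawski1990, §14.2 p. 233; §3.1 p. 19] -/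
theorem exists_continuousMulEquiv_isConj_comp_of_formCongr (L : Type) [Field L] [NumberField L] [IsCMField L]
    (H' : Matrix (Fin 3) (Fin 3) L)
    {v : HeightOneSpectrum (𝓞 ↥(maximalRealSubfield L))} (w : PlacesOver L v) (hw : IsCMField.complexConj L • w.1 = w.1)
    (hJT : ∃ T : GL (Fin 3) (w.1.adicCompletion L), T ∈ glInt 3 (w.1.adicCompletion L) ∧
      placeForm H' w.1 = formCongr (galAdicCompletionMap (L := L) (IsCMField.complexConj L) hw) T ((StdForm.antidiagonal 3).over (w.1.adicCompletion L))) :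
    ∃ ψ : (cmDatum L 3 H').Local v ≃ₜ* ↥(unitaryGroupOfForm (conjLocal L (IsCMField.complexConj L) v) (cmLocalForm L 3 v)),
      ∃ T : GL (Fin 3) (w.1.adicCompletion L), T ∈ glInt 3 (w.1.adicCompletion L) ∧
      placeForm H' w.1 = formCongr (galAdicCompletionMap (L := L) (IsCMField.complexConj L) hw) T
        ((StdForm.antidiagonal 3).over (w.1.adicCompletion L)) ∧
      (∀ g, IsConj ((g.val : GL (Fin 3) (LocalRing L v)))
          (((ψ g : ↥(unitaryGroupOfForm (conjLocal L (IsCMField.complexConj L) v) (cmLocalForm L 3 v))) : GL (Fin 3) (LocalRing L v)))) ∧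
      ∀ g, localGLPiEquiv L 3 v
          (((ψ g : ↥(unitaryGroupOfForm (conjLocal L (IsCMField.complexConj L) v) (cmLocalForm L 3 v))) : GL (Fin 3) (LocalRing L v))) w =
        T * localGLPiEquiv L 3 v (g.val : GL (Fin 3) (LocalRing L v)) w * T⁻¹ := by
  have hc := IsCMField.complexConj_ne_one L
  haveI : Algebra.IsQuadraticExtension ↥(maximalRealSubfield L) L := IsCMField.isQuadraticExtension L
  obtain ⟨T, hT, hJT⟩ := hJT
  have h : formCongr (galAdicCompletionMap (L := L) (IsCMField.complexConj L) hw) T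
      (placeForm (Matrix.of fun i j : Fin 3 => if i.val + j.val + 1 = 3 then (1 : L) else 0) w.1) =
        (1 : w.1.adicCompletion L) • placeForm H' w.1 := by
    rw [one_smul, placeForm_antidiagOne, ← hJT]
  refine ⟨localNonsplitCongr (IsCMField.complexConj L) hc w hw T isUnit_one h, T, hT, hJT, fun g => ?_, fun g =>
    localNonsplitEquiv_localNonsplitCongr (IsCMField.complexConj L) hc w hw T isUnit_one h g⟩
  -- conjugacy in `GL₃(∏ L_{w′})` from the one-component conjugacy
  refine isConj_of_isConj_mulEquiv_aux'
    ((localGLPiEquiv L 3 v).toMulEquiv.trans (localGLPiEvalEquiv (IsCMField.complexConj L) 3 hc w hw).toMulEquiv) ?_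
  show IsConj (localGLPiEquiv L 3 v (g.val : GL (Fin 3) (LocalRing L v)) w)
    (localGLPiEquiv L 3 v (((localNonsplitCongr (IsCMField.complexConj L) hc w hw T isUnit_one h g :
        ↥(unitaryGroupOfForm (conjLocal L (IsCMField.complexConj L) v) (cmLocalForm L 3 v))) : GL (Fin 3) (LocalRing L v))) w)
  have e := localNonsplitEquiv_localNonsplitCongr (IsCMField.complexConj L) hc w hw T isUnit_one h g
  change localGLPiEquiv L 3 v _ w = T * localGLPiEquiv L 3 v _ w * T⁻¹ at e
  rw [e]
  exact isConj_iff.2 ⟨T, rfl⟩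

/-- **THE ENDOSCOPIC SIGN IS `+1` ON THE LEVI STRATUM, AT ANY NON-SPLIT PLACE, OVER THE CONGRUENCE BINDER**: for `H′` with `H′_w = ᵗσT·Φ₃·T` (`T ∈ GL₃(𝒪_w)`) and
`γ_H ∈ H_v` with `ι_v(γ_H) = diag(d)` regular, `κ_v(γ_H, γ₀) = 1` for EVERY `γ₀ ∈ U(H′)(L⁺_v)` matching `γ_H` — ★ T5-Levi `finKappaAt_eq_one_of_levi_of_nonsplit` VERBATIM with
`(hv, hH′w, hH′i) ↦ hJT`: `γ₁ := ψ⁻¹(ι_v γ_H)`, `γ₁,w = T⁻¹ diag(d_w) T`, the column `p′ = T⁻¹e₂` is a `u = d₁`-eigenvector with `H′(p′, p′) = (Φ₃)₂₂ = 1 = 1·σ(1)` (★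
`finKappaAt_eq_one_of_eigenvector_of_exists`); `γ₀ = yγ₁y⁻¹` (★ `isConj_of_isLocalNormPair_of_isLocalNormPair_of_levi`, place-generic) and `κ_v` is a class function (★
`finKappaAt_conj_right`). [cite: Rogawski1990, §14.6 p. 242; §3.5 Prop. 3.5.2 (c) p. 26; §4.3 p. 43] [cite: LanglandsShelstad1987, §2] -/
theorem finKappaAt_eq_one_of_levi_of_formCongr (L : Type) [Field L] [NumberField L] [IsCMField L]
    (H' : Matrix (Fin 3) (Fin 3) L) (hH' : (H'.map (IsCMField.complexConj L))ᵀ = H') (hH'd : IsUnit H'.det)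
    {v : HeightOneSpectrum (𝓞 ↥(maximalRealSubfield L))} (w : PlacesOver L v) (hw : IsCMField.complexConj L • w.1 = w.1)
    (hJT : ∃ T : GL (Fin 3) (w.1.adicCompletion L), T ∈ glInt 3 (w.1.adicCompletion L) ∧
      placeForm H' w.1 = formCongr (galAdicCompletionMap (L := L) (IsCMField.complexConj L) hw) T ((StdForm.antidiagonal 3).over (w.1.adicCompletion L)))
    (γH : (cmDatum L 2 (Matrix.of fun i j : Fin 2 => if i.val + j.val + 1 = 2 then (1 : L) else 0)).Local v ×
      (cmDatum L 1 (Matrix.of fun i j : Fin 1 => if i.val + j.val + 1 = 1 then (1 : L) else 0)).Local v)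
    {d : Fin 3 → (UnitaryGroup.LocalRing L v)ˣ}
    (hι : ((endoEmbLocal L v γH).val : GL (Fin 3) (UnitaryGroup.LocalRing L v)) = glDiagonal 3 (UnitaryGroup.LocalRing L v) d)
    (hreg : ∀ i j, i ≠ j → IsUnit ((d i : UnitaryGroup.LocalRing L v) - d j)) {γ₀ : (cmDatum L 3 H').Local v}
    (h₀ : IsLocalNormPair L H' v γH γ₀) : finKappaAt L v H' γH γ₀ = 1 := by
  classical
  have hc := IsCMField.complexConj_ne_one L
  haveI : Algebra.IsQuadraticExtension ↥(maximalRealSubfield L) L := IsCMField.isQuadraticExtension L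
  have hvs : Subsingleton (PlacesOver L v) := PlacesOver.subsingleton_of_smul_eq (IsCMField.complexConj L) hc w hw
  have ht := endoEmbLocal_mem_torusU_of_endoEmbLocal_eq L v γH hι
  have ha : IsUnit ((((d 0)⁻¹ * d 1 : (UnitaryGroup.LocalRing L v)ˣ) : UnitaryGroup.LocalRing L v) - 1) :=
    (HeisRing.isUnit_coe_inv_mul_sub_one_iff d 0 1).2 (hreg 1 0 (by decide))
  have hu : IsUnit ((finCharpolyTwo L v γH).eval (finGammaTwo L v γH)) := by
    rw [eval_finCharpolyTwo_eq_of_endoEmbLocal_eq L v γH hι]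
    exact HeisRing.isUnit_weylNumerator (conjLocal L (IsCMField.complexConj L) v) (cmLocalForm_eq_over L 3 v) ⟨_, ht⟩ hι.symm ha
  obtain ⟨ψ, T, -, hJT, hconjψ, hcomp⟩ := exists_continuousMulEquiv_isConj_comp_of_formCongr L H' w hw hJT
  set γ₁ : (cmDatum L 3 H').Local v :=
    ψ.symm (endoEmbLocal L v γH : ↥(unitaryGroupOfForm (conjLocal L (IsCMField.complexConj L) v) (cmLocalForm L 3 v))) with hγ₁
  have hψ : ψ γ₁ = (endoEmbLocal L v γH : ↥(unitaryGroupOfForm (conjLocal L (IsCMField.complexConj L) v) (cmLocalForm L 3 v))) :=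
    ψ.apply_symm_apply _
  have h₁ : IsLocalNormPair L H' v γH γ₁ := by have h := hconjψ γ₁; rw [hψ] at h; exact h.symm
  obtain ⟨y, hy⟩ := isConj_iff.1 (isConj_of_isLocalNormPair_of_isLocalNormPair_of_levi L H' hH' hH'd γH hι hreg h₁ h₀)
  rw [← hy, finKappaAt_conj_right L v H' γH γ₁ y h₁]
  -- the `w`-components: `γ₁,w = T⁻¹ · diag(d_w) · T`
  have hGw : localGLPiEquiv L 3 v γ₁.val w =
      T⁻¹ * localGLPiEquiv L 3 v ((endoEmbLocal L v γH).val : GL (Fin 3) (UnitaryGroup.LocalRing L v)) w * T := by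
    have h := hcomp γ₁; rw [hψ] at h
    change localGLPiEquiv L 3 v ((endoEmbLocal L v γH).val : GL (Fin 3) (UnitaryGroup.LocalRing L v)) w = _ at h
    rw [h]; group
  have htw : ∀ i j, ((localGLPiEquiv L 3 v ((endoEmbLocal L v γH).val : GL (Fin 3) (UnitaryGroup.LocalRing L v)) w :
      GL (Fin 3) (w.1.adicCompletion L)) : Matrix (Fin 3) (Fin 3) (w.1.adicCompletion L)) i j =
        (Matrix.diagonal fun k => (d k : UnitaryGroup.LocalRing L v) w) i j := by
    intro i j; rw [localGLPiEquiv_apply_apply, hι, coe_glDiagonal, Matrix.diagonal_apply, Matrix.diagonal_apply]; split_ifs <;> rfl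
  have hM : ∀ i j, (γ₁.val.val : Matrix (Fin 3) (Fin 3) (UnitaryGroup.LocalRing L v)) i j w =
      (((T⁻¹ : GL (Fin 3) (w.1.adicCompletion L)) : Matrix (Fin 3) (Fin 3) (w.1.adicCompletion L)) *
        (Matrix.diagonal fun k => (d k : UnitaryGroup.LocalRing L v) w) * (T : Matrix (Fin 3) (Fin 3) (w.1.adicCompletion L))) i j := by
    intro i j; rw [← localGLPiEquiv_apply_apply, hGw, Units.val_mul, Units.val_mul, Matrix.ext htw]
  -- the eigenvector `p′ = T⁻¹ e₂`
  letI : Unique (PlacesOver L v) := @uniqueOfSubsingleton _ hvs w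
  obtain ⟨p', hp'w⟩ : ∃ p' : Fin 3 → UnitaryGroup.LocalRing L v,
      ∀ i, p' i w = ((T⁻¹ : GL (Fin 3) (w.1.adicCompletion L)) : Matrix (Fin 3) (Fin 3) (w.1.adicCompletion L)) i 1 :=
    ⟨fun i => (RingEquiv.piUnique fun w' : PlacesOver L v => w'.1.adicCompletion L).symm
        (((T⁻¹ : GL (Fin 3) (w.1.adicCompletion L)) : Matrix (Fin 3) (Fin 3) (w.1.adicCompletion L)) i 1),
      fun i => (RingEquiv.piUnique fun w' : PlacesOver L v => w'.1.adicCompletion L).apply_symm_apply _⟩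
  have hne : p' ≠ 0 := fun h0 => by
    have hcol : ∀ i, ((T⁻¹ : GL (Fin 3) (w.1.adicCompletion L)) : Matrix (Fin 3) (Fin 3) (w.1.adicCompletion L)) i 1 = 0 := fun i => by
      rw [← hp'w i, h0, Pi.zero_apply, Pi.zero_apply]
    have h11 : ((T : Matrix (Fin 3) (Fin 3) (w.1.adicCompletion L)) *
        ((T⁻¹ : GL (Fin 3) (w.1.adicCompletion L)) : Matrix (Fin 3) (Fin 3) (w.1.adicCompletion L))) 1 1 = 1 := by
      rw [Units.mul_inv, Matrix.one_apply_eq]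
    rw [Matrix.mul_apply] at h11; simp only [hcol, mul_zero, Finset.sum_const_zero] at h11; exact zero_ne_one h11
  have hp' : (γ₁.val.val : Matrix (Fin 3) (Fin 3) (UnitaryGroup.LocalRing L v)) *ᵥ p' =
      finGammaTwo L v γH • p' := by
    funext i
    rw [LocalRing.eq_iff_apply_eq (IsCMField.complexConj L) hc w hw, finGammaTwo_eq_of_endoEmbLocal_eq L v γH hι]
    simp only [Matrix.mulVec, dotProduct, Finset.sum_apply, Pi.mul_apply, Pi.smul_apply, smul_eq_mul, hM, hp'w]
    rw [← Matrix.mul_apply]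
    have hTT : (T : Matrix (Fin 3) (Fin 3) (w.1.adicCompletion L)) * ((T⁻¹ : GL (Fin 3) (w.1.adicCompletion L)) :
        Matrix (Fin 3) (Fin 3) (w.1.adicCompletion L)) = 1 := Units.mul_inv T
    rw [Matrix.mul_assoc, hTT, Matrix.mul_one, Matrix.mul_diagonal, mul_comm]
  -- the `H′`-value of `p′` is `(Φ₃)₂₂ = 1`
  have hx : (∑ i : Fin 3, ∑ k : Fin 3, UnitaryGroup.conjLocal L (IsCMField.complexConj L) v (p' i) *
      ((UnitaryGroup.adelicForm L 3 H').map (UnitaryGroup.adeleToLocal L v)) i k * p' k) = 1 := by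
    rw [LocalRing.eq_iff_apply_eq (IsCMField.complexConj L) hc w hw]
    simp only [Finset.sum_apply, Pi.mul_apply, Pi.one_apply, conjLocal_apply_eq_galAdicCompletionMap L v w hw, localGram_apply_apply, hp'w]
    have hΦ : formCongr (galAdicCompletionMap (L := L) (IsCMField.complexConj L) hw) T⁻¹ (placeForm H' w.1) =
        (StdForm.antidiagonal 3).over (w.1.adicCompletion L) := by
      rw [hJT, formCongr_inv_formCongr]
    have h11 := congrArg (fun M : Matrix (Fin 3) (Fin 3) (w.1.adicCompletion L) => M 1 1) hΦ
    simp only [formCongr, Matrix.mul_apply, Matrix.transpose_apply, Matrix.map_apply, StdForm.over_antidiagonal_apply, Finset.sum_mul] at h11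
    rw [Finset.sum_comm]; simpa using h11
  exact finKappaAt_eq_one_of_eigenvector_of_exists L v H' γH γ₁ hvs h₁ hu hp' hne ⟨1, isUnit_one, by rw [hx, map_one, mul_one]⟩

/-! ## §4 HEAD: `Δ‴_v(γ_H, γ₀) = μ_v(d₀) · ‖d₀⁻¹u − 1‖` on the Levi stratum, any non-split place -/

/-- **ROGAWSKI'S TRANSFER FACTOR ON THE LEVI STRATUM AT ANY NON-SPLIT PLACE: `Δ‴_v(γ_H, γ₀) = μ_v(d₀) · ‖d₀⁻¹d₁ − 1‖`.**  At a finite place `v` of `L⁺` NON-SPLIT in `L`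
(tame or wild, `|2|_w` arbitrary), for `H′` hermitian with the integral congruence `H′_w = ᵗσT·Φ₃·T` (`hJT`; `T = 1` for `H′ = Φ₃`), `μ` under print's guard `μ|_{𝕀_{L⁺}} = ω_{L∕L⁺}`
(possibly RAMIFIED at `w`), and `γ_H ∈ H_v` with `ι_v(γ_H) = diag(d₀, d₁, d₂) ∈ T(𝒪_v)` REGULAR: at EVERY matching `γ₀ ∈ U(H′)(L⁺_v)`,
`Δ‴_v(γ_H, γ₀) = τ_v · D_v · κ_v` with `τ_v = μ_v(d₀)` (§2), `D_v = ‖a − 1‖·√‖d₀‖ = ‖a − 1‖` (★ `sqrt_prod_norm_weylNumerator_cmLocal`, `‖d₀‖ = 1` on `T(𝒪_v)`), `κ_v = 1` (§3):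
**`Δ‴_v(γ_H, γ₀) = μ_v(d₀) · ‖a − 1‖`**, `a = d₀⁻¹d₁`, `‖·‖ = unitModulusChar (∏_{w∣v} L_w)`.  ★ T5-Levi `finExplicitDelta_eq_unitModulusChar_of_levi_of_nonsplit` is the case
`hv + μ unramified` (`μ_v(d₀) = 1`).  Print: «`Δ_{G∕H}(γ) = τ(γ)D_{G∕H}(γ)`», `τ(γ) = μ(γ₂)μ⁻¹((γ₂γ₁⁻¹ − 1)(1 − γ₂γ₃⁻¹))`.
[cite: Rogawski1990, §4.9 p. 55, Prop. 4.9.1 (b); §4.3 p. 43; §14.6 p. 242] [cite: LanglandsShelstad1987, §2] -/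
theorem finExplicitDelta_eq_finHeckeValue_mul_unitModulusChar_of_levi_of_formCongr (L : Type) [Field L] [NumberField L] [IsCMField L]
    (H' : Matrix (Fin 3) (Fin 3) L) (hH' : (H'.map (IsCMField.complexConj L))ᵀ = H') (hH'd : IsUnit H'.det)
    {v : HeightOneSpectrum (𝓞 ↥(maximalRealSubfield L))} (w : PlacesOver L v) (hw : IsCMField.complexConj L • w.1 = w.1)
    (hJT : ∃ T : GL (Fin 3) (w.1.adicCompletion L), T ∈ glInt 3 (w.1.adicCompletion L) ∧
      placeForm H' w.1 = formCongr (galAdicCompletionMap (L := L) (IsCMField.complexConj L) hw) T ((StdForm.antidiagonal 3).over (w.1.adicCompletion L)))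
    (μ : HeckeCharacter L)
    (hμω : ∀ x : ideleGroup ↥(maximalRealSubfield L), μ (AdeleRing.ideleBaseChange ↥(maximalRealSubfield L) L x) = quadraticHeckeCharCM L x)
    (γH : (cmDatum L 2 (Matrix.of fun i j : Fin 2 => if i.val + j.val + 1 = 2 then (1 : L) else 0)).Local v ×
      (cmDatum L 1 (Matrix.of fun i j : Fin 1 => if i.val + j.val + 1 = 1 then (1 : L) else 0)).Local v)
    {d : Fin 3 → (UnitaryGroup.LocalRing L v)ˣ}
    (hι : ((endoEmbLocal L v γH).val : GL (Fin 3) (UnitaryGroup.LocalRing L v)) = glDiagonal 3 (UnitaryGroup.LocalRing L v) d)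
    (hreg : ∀ i j, i ≠ j → IsUnit ((d i : UnitaryGroup.LocalRing L v) - d j))
    (hint : endoEmbLocal L v γH ∈ cmLocalIntegralLevel L 3 (Matrix.of fun i j : Fin 3 => if i.val + j.val + 1 = 3 then (1 : L) else 0) v)
    (ha : IsUnit ((((d 0)⁻¹ * d 1 : (UnitaryGroup.LocalRing L v)ˣ) : UnitaryGroup.LocalRing L v) - 1))
    {γ₀ : (cmDatum L 3 H').Local v} (h₀ : IsLocalNormPair L H' v γH γ₀) :
    finExplicitDelta L v H' γH μ γ₀ =
      finHeckeValue L v μ (d 0 : UnitaryGroup.LocalRing L v) * (((unitModulusChar (UnitaryGroup.LocalRing L v) ha.unit : ℝ≥0) : ℝ) : ℂ) := by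
  classical
  have ht := endoEmbLocal_mem_torusU_of_endoEmbLocal_eq L v γH hι
  rw [finExplicitDelta_of_isLocalNormPair L v H' γH μ h₀, finTau_eq_finHeckeValue_of_levi L w hw μ hμω γH hι ha,
    finKappaAt_eq_one_of_levi_of_formCongr L H' hH' hH'd w hw hJT γH hι hreg h₀, Int.cast_one, mul_one]
  unfold finWeylRatio
  rw [eval_finCharpolyTwo_eq_of_endoEmbLocal_eq L v γH hι, sqrt_prod_norm_weylNumerator_cmLocal L v ht hι.symm ha,
    unitModulusChar_eq_one_of_endoEmbLocal_mem L v γH hι hint 0, NNReal.coe_one, Real.sqrt_one, mul_one]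

/-- **THE SAME FOR THE QUASI-SPLIT `U(Φ₃) = U(2,1)`** (`H′ = Φ₃`, `T = 1`, ★ `formCongr_one_eq`, ★ `placeForm_antidiagOne`): on the Levi stratum at ANY non-split place,
**`Δ‴_v(γ_H, γ₀) = μ_v(d₀) · ‖d₀⁻¹d₁ − 1‖`** for every `γ₀ ∈ U(Φ₃)(L⁺_v)` matching `γ_H` — the FOUR-FRAME anchor's Levi dictionary.
[cite: Rogawski1990, §4.9 p. 55, Prop. 4.9.1 (b); §14.6 p. 242] -/
theorem finExplicitDelta_eq_finHeckeValue_mul_unitModulusChar_of_levi_antidiagOne (L : Type) [Field L] [NumberField L] [IsCMField L]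
    {v : HeightOneSpectrum (𝓞 ↥(maximalRealSubfield L))} (w : PlacesOver L v) (hw : IsCMField.complexConj L • w.1 = w.1)
    (μ : HeckeCharacter L)
    (hμω : ∀ x : ideleGroup ↥(maximalRealSubfield L), μ (AdeleRing.ideleBaseChange ↥(maximalRealSubfield L) L x) = quadraticHeckeCharCM L x)
    (γH : (cmDatum L 2 (Matrix.of fun i j : Fin 2 => if i.val + j.val + 1 = 2 then (1 : L) else 0)).Local v ×
      (cmDatum L 1 (Matrix.of fun i j : Fin 1 => if i.val + j.val + 1 = 1 then (1 : L) else 0)).Local v)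
    {d : Fin 3 → (UnitaryGroup.LocalRing L v)ˣ}
    (hι : ((endoEmbLocal L v γH).val : GL (Fin 3) (UnitaryGroup.LocalRing L v)) = glDiagonal 3 (UnitaryGroup.LocalRing L v) d)
    (hreg : ∀ i j, i ≠ j → IsUnit ((d i : UnitaryGroup.LocalRing L v) - d j))
    (hint : endoEmbLocal L v γH ∈ cmLocalIntegralLevel L 3 (Matrix.of fun i j : Fin 3 => if i.val + j.val + 1 = 3 then (1 : L) else 0) v)
    (ha : IsUnit ((((d 0)⁻¹ * d 1 : (UnitaryGroup.LocalRing L v)ˣ) : UnitaryGroup.LocalRing L v) - 1))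
    {γ₀ : (cmDatum L 3 (Matrix.of fun i j : Fin 3 => if i.val + j.val + 1 = 3 then (1 : L) else 0)).Local v}
    (h₀ : IsLocalNormPair L (Matrix.of fun i j : Fin 3 => if i.val + j.val + 1 = 3 then (1 : L) else 0) v γH γ₀) :
    finExplicitDelta L v (Matrix.of fun i j : Fin 3 => if i.val + j.val + 1 = 3 then (1 : L) else 0) γH μ γ₀ =
      finHeckeValue L v μ (d 0 : UnitaryGroup.LocalRing L v) * (((unitModulusChar (UnitaryGroup.LocalRing L v) ha.unit : ℝ≥0) : ℝ) : ℂ) :=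
  finExplicitDelta_eq_finHeckeValue_mul_unitModulusChar_of_levi_of_formCongr L
    (Matrix.of fun i j : Fin 3 => if i.val + j.val + 1 = 3 then (1 : L) else 0)
    (antidiagOne_map_transpose (IsCMField.complexConj L) 3) (isUnit_antidiagOne_det L 3) w hw
    ⟨1, one_mem _, by rw [formCongr_one_eq, placeForm_antidiagOne]⟩ μ hμω γH hι hreg hint ha h₀

/-! ## §5 The germ at `1 ∈ H_v`: `Δ‴_v(γ_H, γ₀) = ‖d′₀⁻¹u − 1‖` near `1`, in the binder currency of ★ L7 -/

/-- The valuation ball `{x | |x − 1|_w ≤ |c|_w}` (`c ≠ 0`) is a neighbourhood of `1` in `L_w`. [cite: Serre1979, Ch. II §1] -/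
private theorem setOf_valued_sub_one_le_mem_nhds_one' (L : Type) [Field L] [NumberField L]
    {v : HeightOneSpectrum (𝓞 ↥(maximalRealSubfield L))} (w : PlacesOver L v) {c : w.1.adicCompletion L} (hc : c ≠ 0) :
    {x : w.1.adicCompletion L | Valued.v (x - 1) ≤ Valued.v c} ∈ 𝓝 (1 : w.1.adicCompletion L) := by
  refine Filter.mem_of_superset (Metric.closedBall_mem_nhds (1 : w.1.adicCompletion L) (norm_pos_iff.2 hc)) fun x hx => ?_
  rw [Metric.mem_closedBall, dist_eq_norm] at hx
  exact Valued.toNormedField.norm_le_iff.1 hx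

/-- **THE GERM OF THE LEVI VALUE AT `1 ∈ H_v` — ★ L7's binder `hΔ`.**  Non-split `v`, ANY ramification, `H′_w = ᵗσT·Φ₃·T` (`hJT`), guard `μ|_{𝕀_{L⁺}} = ω`: there is a
neighbourhood `V ∋ 1` of `H_v` such that for every `γ_H = (diag(d′₀, d′₁), u) ∈ V ∩ K_H` on the Levi stratum with `d′₀⁻¹u − 1`, `d′₀⁻¹d′₁ − 1`, `u − d′₁` units (★ L7's
`hd′ hγH ha hb h12` VERBATIM) and every matching `γ₀ ∈ U(H′)(L⁺_v)`: **`Δ‴_v(γ_H, γ₀) = ‖d′₀⁻¹u − 1‖`** — §4 with `μ_v(d′₀) = 1`, because `μ_w ≡ 1` on a ball around `1` (★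
`exists_finHeckeValue_eq_one_of_valued_sub_one_le`) and `γ_H ↦ (d′₀)_w = (g₀₀)_w` is continuous (★ `continuous_fst_localMatrix`).  This is the `hΔ` of ★
`stableOrbitalIntegralRel_indicator_eq_finsum_delta_of_levi_of_formCongr` for Rogawski's `Δ‴_v`, for all `γ_H ∈ V` at once. [cite: Rogawski1990, §4.9 p. 55, Prop. 4.9.1 (b); §4.3 p. 43]
[cite: TateThesis1967, §2.3] -/
theorem exists_nhds_one_forall_finExplicitDelta_eq_unitModulusChar_of_levi_of_formCongr (L : Type) [Field L] [NumberField L] [IsCMField L]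
    (H' : Matrix (Fin 3) (Fin 3) L) (hH' : (H'.map (IsCMField.complexConj L))ᵀ = H') (hH'd : IsUnit H'.det)
    {v : HeightOneSpectrum (𝓞 ↥(maximalRealSubfield L))} (w : PlacesOver L v) (hw : IsCMField.complexConj L • w.1 = w.1)
    (hJT : ∃ T : GL (Fin 3) (w.1.adicCompletion L), T ∈ glInt 3 (w.1.adicCompletion L) ∧
      placeForm H' w.1 = formCongr (galAdicCompletionMap (L := L) (IsCMField.complexConj L) hw) T ((StdForm.antidiagonal 3).over (w.1.adicCompletion L)))
    (μ : HeckeCharacter L)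
    (hμω : ∀ x : ideleGroup ↥(maximalRealSubfield L), μ (AdeleRing.ideleBaseChange ↥(maximalRealSubfield L) L x) = quadraticHeckeCharCM L x) :
    ∃ V ∈ 𝓝 (1 : (cmDatum L 2 (Matrix.of fun i j : Fin 2 => if i.val + j.val + 1 = 2 then (1 : L) else 0)).Local v ×
        (cmDatum L 1 (Matrix.of fun i j : Fin 1 => if i.val + j.val + 1 = 1 then (1 : L) else 0)).Local v),
      ∀ γH ∈ V, ∀ (d' : Fin 2 → (UnitaryGroup.LocalRing L v)ˣ),
        glDiagonal 2 (UnitaryGroup.LocalRing L v) d' = (γH.1.val : GL (Fin 2) (UnitaryGroup.LocalRing L v)) →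
        γH ∈ ((cmLocalIntegralLevel L 2 (Matrix.of fun i j : Fin 2 => if i.val + j.val + 1 = 2 then (1 : L) else 0) v).prod
          (cmLocalIntegralLevel L 1 (Matrix.of fun i j : Fin 1 => if i.val + j.val + 1 = 1 then (1 : L) else 0) v)) →
        ∀ (ha : IsUnit ((((d' 0)⁻¹ * (isUnit_finGammaTwo L v γH).unit : (UnitaryGroup.LocalRing L v)ˣ) : UnitaryGroup.LocalRing L v) - 1)),
        IsUnit ((((d' 0)⁻¹ * d' 1 : (UnitaryGroup.LocalRing L v)ˣ) : UnitaryGroup.LocalRing L v) - 1) →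
        IsUnit (finGammaTwo L v γH - (d' 1 : UnitaryGroup.LocalRing L v)) →
        ∀ γ₀ : (cmDatum L 3 H').Local v, IsLocalNormPair L H' v γH γ₀ →
          finExplicitDelta L v H' γH μ γ₀ = (((unitModulusChar (UnitaryGroup.LocalRing L v) ha.unit : ℝ≥0) : ℝ) : ℂ) := by
  classical
  haveI : Algebra.IsQuadraticExtension ↥(maximalRealSubfield L) L := IsCMField.isQuadraticExtension L
  obtain ⟨M₁, -, hM₁⟩ := exists_finHeckeValue_eq_one_of_valued_sub_one_le L v w hw μ
  have hϖ0 : (toPlace v w (HeckeCharacter.uniformizer ↥(maximalRealSubfield L) v : v.adicCompletion ↥(maximalRealSubfield L))) ^ M₁ ≠ 0 := by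
    refine pow_ne_zero _ ?_
    rw [map_ne_zero]
    exact_mod_cast (HeckeCharacter.uniformizer ↥(maximalRealSubfield L) v).ne_zero
  -- `γ_H ↦ (g₀₀)_w` is continuous and `= 1` at `γ_H = 1`
  have hcont : Continuous fun γH : (cmDatum L 2 (Matrix.of fun i j : Fin 2 => if i.val + j.val + 1 = 2 then (1 : L) else 0)).Local v ×
      (cmDatum L 1 (Matrix.of fun i j : Fin 1 => if i.val + j.val + 1 = 1 then (1 : L) else 0)).Local v =>
        (γH.1.val.val : Matrix (Fin 2) (Fin 2) (UnitaryGroup.LocalRing L v)) 0 0 w :=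
    (continuous_apply w).comp ((continuous_fst_localMatrix L v).matrix_elem 0 0)
  have h1 : ((1 : (cmDatum L 2 (Matrix.of fun i j : Fin 2 => if i.val + j.val + 1 = 2 then (1 : L) else 0)).Local v ×
      (cmDatum L 1 (Matrix.of fun i j : Fin 1 => if i.val + j.val + 1 = 1 then (1 : L) else 0)).Local v).1.val.val :
        Matrix (Fin 2) (Fin 2) (UnitaryGroup.LocalRing L v)) 0 0 w = 1 := by
    change (1 : Matrix (Fin 2) (Fin 2) (UnitaryGroup.LocalRing L v)) 0 0 w = 1
    rw [Matrix.one_apply_eq, Pi.one_apply]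
  have hball := setOf_valued_sub_one_le_mem_nhds_one' L w hϖ0
  refine ⟨_, hcont.continuousAt.preimage_mem_nhds (by rw [h1]; exact hball), fun γH hγ d' hd' hγH ha hb h12 γ₀ h₀ => ?_⟩
  -- the stratum data in `ι_v`-coordinates
  have hι := endoEmbLocal_eq_glDiagonal_of_fst_eq L v γH hd'
  have hint := endoEmbLocal_mem_cmLocalIntegralLevel_of_nonsplit L w hw hγH
  have hu : (((isUnit_finGammaTwo L v γH).unit : (UnitaryGroup.LocalRing L v)ˣ) : UnitaryGroup.LocalRing L v) = finGammaTwo L v γH :=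
    (isUnit_finGammaTwo L v γH).unit_spec
  have hreg3 := isUnit_vecCons_sub_of_levi ha hb (by rw [hu]; exact h12)
  rw [finExplicitDelta_eq_finHeckeValue_mul_unitModulusChar_of_levi_of_formCongr L H' hH' hH'd w hw hJT μ hμω γH hι hreg3 hint ha h₀]
  -- `μ_v(d′₀) = 1` on `V`
  have hd0 : ((d' 0 : (UnitaryGroup.LocalRing L v)ˣ) : UnitaryGroup.LocalRing L v) =
      (γH.1.val.val : Matrix (Fin 2) (Fin 2) (UnitaryGroup.LocalRing L v)) 0 0 := by
    have h := congrArg (fun g : GL (Fin 2) (UnitaryGroup.LocalRing L v) => (g : Matrix (Fin 2) (Fin 2) (UnitaryGroup.LocalRing L v)) 0 0) hd'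
    simp only [coe_glDiagonal, Matrix.diagonal_apply_eq] at h
    exact h
  have hd0w : ((d' 0 : (UnitaryGroup.LocalRing L v)ˣ) : UnitaryGroup.LocalRing L v) w ≠ 0 := (Pi.isUnit_iff.1 (d' 0).isUnit w).ne_zero
  have hμ1 : finHeckeValue L v μ ((d' 0 : (UnitaryGroup.LocalRing L v)ˣ) : UnitaryGroup.LocalRing L v) = 1 :=
    hM₁ _ hd0w (by rw [hd0]; exact hγ)
  change finHeckeValue L v μ ((d' 0 : (UnitaryGroup.LocalRing L v)ˣ) : UnitaryGroup.LocalRing L v) * _ = _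
  rw [hμ1, one_mul]
  rfl

/-- **THE GERM FOR `U(Φ₃) = U(2,1)` (`H′ = Φ₃`, `T = 1`) AT ANY NON-SPLIT PLACE**: the binder `hΔ` of ★ L7 `stableOrbitalIntegralRel_indicator_eq_finsum_delta_of_levi_antidiagOne`
for Rogawski's `Δ‴_v`, on a neighbourhood of `1 ∈ H_v` — the FOUR-FRAME anchor's Levi row input, tame or WILD. [cite: Rogawski1990, §4.9 p. 55, Prop. 4.9.1 (b); §4.3 p. 43] -/
theorem exists_nhds_one_forall_finExplicitDelta_eq_unitModulusChar_of_levi_antidiagOne (L : Type) [Field L] [NumberField L] [IsCMField L]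
    {v : HeightOneSpectrum (𝓞 ↥(maximalRealSubfield L))} (w : PlacesOver L v) (hw : IsCMField.complexConj L • w.1 = w.1)
    (μ : HeckeCharacter L)
    (hμω : ∀ x : ideleGroup ↥(maximalRealSubfield L), μ (AdeleRing.ideleBaseChange ↥(maximalRealSubfield L) L x) = quadraticHeckeCharCM L x) :
    ∃ V ∈ 𝓝 (1 : (cmDatum L 2 (Matrix.of fun i j : Fin 2 => if i.val + j.val + 1 = 2 then (1 : L) else 0)).Local v ×
        (cmDatum L 1 (Matrix.of fun i j : Fin 1 => if i.val + j.val + 1 = 1 then (1 : L) else 0)).Local v),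
      ∀ γH ∈ V, ∀ (d' : Fin 2 → (UnitaryGroup.LocalRing L v)ˣ),
        glDiagonal 2 (UnitaryGroup.LocalRing L v) d' = (γH.1.val : GL (Fin 2) (UnitaryGroup.LocalRing L v)) →
        γH ∈ ((cmLocalIntegralLevel L 2 (Matrix.of fun i j : Fin 2 => if i.val + j.val + 1 = 2 then (1 : L) else 0) v).prod
          (cmLocalIntegralLevel L 1 (Matrix.of fun i j : Fin 1 => if i.val + j.val + 1 = 1 then (1 : L) else 0) v)) →
        ∀ (ha : IsUnit ((((d' 0)⁻¹ * (isUnit_finGammaTwo L v γH).unit : (UnitaryGroup.LocalRing L v)ˣ) : UnitaryGroup.LocalRing L v) - 1)),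
        IsUnit ((((d' 0)⁻¹ * d' 1 : (UnitaryGroup.LocalRing L v)ˣ) : UnitaryGroup.LocalRing L v) - 1) →
        IsUnit (finGammaTwo L v γH - (d' 1 : UnitaryGroup.LocalRing L v)) →
        ∀ γ₀ : (cmDatum L 3 (Matrix.of fun i j : Fin 3 => if i.val + j.val + 1 = 3 then (1 : L) else 0)).Local v,
          IsLocalNormPair L (Matrix.of fun i j : Fin 3 => if i.val + j.val + 1 = 3 then (1 : L) else 0) v γH γ₀ →
          finExplicitDelta L v (Matrix.of fun i j : Fin 3 => if i.val + j.val + 1 = 3 then (1 : L) else 0) γH μ γ₀ =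
            (((unitModulusChar (UnitaryGroup.LocalRing L v) ha.unit : ℝ≥0) : ℝ) : ℂ) :=
  exists_nhds_one_forall_finExplicitDelta_eq_unitModulusChar_of_levi_of_formCongr L
    (Matrix.of fun i j : Fin 3 => if i.val + j.val + 1 = 3 then (1 : L) else 0)
    (antidiagOne_map_transpose (IsCMField.complexConj L) 3) (isUnit_antidiagOne_det L 3) w hw
    ⟨1, one_mem _, by rw [formCongr_one_eq, placeForm_antidiagOne]⟩ μ hμω

end Literature.NumberTheory.Rogawski1990

end
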